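import Mathlib

/-!
# Isotypic decomposition of a SMOOTH representation of an abelian group (kernel witness for the
standard fact (A1) with no finiteness on the group)

Blind cell `pub-hodge-repro2`, seat p4, Tier-5 support. README §8(d): this file uses an
L-value-free non-vanishing device: NO (a kernel check of a standard fact already on the cell's
record).

The standard fact (A1) of `route/T5-route-2.md` §N5.11.7 (owner route-2, sub-step N5; used in
Lemma N5.L3 / Corollary N5.L3′) says that a smooth representation of the compact totally
disconnected group `E¹_v` is the direct sum of its isotypic components `ω[α]`. The finite-group
core is `T5CharacterProjectors.lean` (p391097); the independence half for any group is
`T5IsotypicIndependence.lean` (p391506). Here the full statement is kernel-checked for an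
arbitrary abelian group `A` (written additively) and an arbitrary complex representation `ρ` that
is SMOOTH in the algebraic sense: every vector is fixed by a subgroup of FINITE INDEX (for a compact
totally disconnected group the open subgroups are exactly the subgroups of finite index that are
closed, so this is the usual smoothness; the topology itself is not modelled).

* `isotypic ρ α` — the `α`-isotypic subspace, `α : AddChar A ℂ` a character of `A`;
* `fixedBy ρ K` — the `K`-fixed vectors;
* `projQ ρ K ᾱ v = |A/K|⁻¹ ∑_{q ∈ A/K} ᾱ(q)⁻¹ ρ(q̃) v` — the projector attached to a character
  `ᾱ` of the finite quotient `A/K` (`q̃` any lift), on `K`-fixed vectors;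
* `projQ_mem_isotypic`, `sum_projQ` — `e_ᾱ v ∈ V[ᾱ ∘ mk]` and `∑_ᾱ e_ᾱ v = v` for `K`-fixed `v`;
* `mem_iSup_isotypic_of_mem_fixedBy` — a `K`-fixed vector (`K` of finite index) is a sum of
  isotypic vectors; `iSup_isotypic_eq_top_of_smooth` — the spanning half for smooth `ρ`;
* `iSupIndep_isotypic` — the independence half (Dedekind, any abelian group);
* **`isInternal_isotypic_of_smooth`** — `V = ⨁_α V[α]` for every smooth representation.

Mathlib only; no sorry; axioms ⊆ {propext, Classical.choice, Quot.sound}.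
-/

namespace Summit.Ventures.HodgeRepro2.T5SmoothIsotypic

open Multiplicative

variable {A : Type*} [AddCommGroup A] {V : Type*} [AddCommGroup V] [Module ℂ V]

/-- The `α`-isotypic subspace. -/
def isotypic (ρ : Representation ℂ (Multiplicative A) V) (α : AddChar A ℂ) : Submodule ℂ V where
  carrier := {v | ∀ a : A, ρ (ofAdd a) v = α a • v}
  zero_mem' := by intro a; simp
  add_mem' := by
    intro v w hv hw a
    simp only [Set.mem_setOf_eq] at hv hw
    rw [map_add, hv a, hw a, smul_add]
  smul_mem' := by
    intro c v hv a
    simp only [Set.mem_setOf_eq] at hv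
    rw [map_smul, hv a, smul_comm]

/-- Membership in the isotypic subspace. -/
theorem mem_isotypic {ρ : Representation ℂ (Multiplicative A) V} {α : AddChar A ℂ} {v : V} :
    v ∈ isotypic ρ α ↔ ∀ a : A, ρ (ofAdd a) v = α a • v := Iff.rfl

/-- The `K`-fixed vectors. -/
def fixedBy (ρ : Representation ℂ (Multiplicative A) V) (K : AddSubgroup A) : Submodule ℂ V where
  carrier := {v | ∀ k ∈ K, ρ (ofAdd k) v = v}
  zero_mem' := by intro k _; simp
  add_mem' := by
    intro v w hv hw k hk
    simp only [Set.mem_setOf_eq] at hv hw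
    rw [map_add, hv k hk, hw k hk]
  smul_mem' := by
    intro c v hv k hk
    simp only [Set.mem_setOf_eq] at hv
    rw [map_smul, hv k hk]

/-- Membership in the fixed subspace. -/
theorem mem_fixedBy {ρ : Representation ℂ (Multiplicative A) V} {K : AddSubgroup A} {v : V} :
    v ∈ fixedBy ρ K ↔ ∀ k ∈ K, ρ (ofAdd k) v = v := Iff.rfl

/-- On `K`-fixed vectors, `ρ x` depends only on the coset of `x` modulo `K`. -/
theorem rho_eq_of_sub_mem {ρ : Representation ℂ (Multiplicative A) V} {K : AddSubgroup A} {v : V}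
    (hv : v ∈ fixedBy ρ K) {x y : A} (h : -y + x ∈ K) : ρ (ofAdd x) v = ρ (ofAdd y) v := by
  have : x = y + (-y + x) := by abel
  rw [this, ofAdd_add, map_mul, Module.End.mul_apply, hv _ h]

/-- On `K`-fixed vectors, `ρ x` depends only on the class of `x` in `A ⧸ K`. -/
theorem rho_eq_of_mk_eq {ρ : Representation ℂ (Multiplicative A) V} {K : AddSubgroup A} {v : V}
    (hv : v ∈ fixedBy ρ K) {x y : A} (h : (x : A ⧸ K) = y) : ρ (ofAdd x) v = ρ (ofAdd y) v :=
  rho_eq_of_sub_mem hv (QuotientAddGroup.eq.mp h.symm)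

section Quotient

variable (ρ : Representation ℂ (Multiplicative A) V) (K : AddSubgroup A)

/-- The character of `A` obtained from a character `ᾱ` of `A ⧸ K` (trivial on `K`). -/
def inflate (ᾱ : AddChar (A ⧸ K) ℂ) : AddChar A ℂ :=
  ᾱ.compAddMonoidHom (QuotientAddGroup.mk' K)

/-- `inflate ᾱ a = ᾱ (a : A ⧸ K)`. -/
theorem inflate_apply (ᾱ : AddChar (A ⧸ K) ℂ) (a : A) : inflate K ᾱ a = ᾱ (a : A ⧸ K) := rfl

variable [Fintype (A ⧸ K)]

/-- The projector attached to a character `ᾱ` of the finite quotient, defined through lifts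
`q.out` of the cosets: `e_ᾱ v = |A/K|⁻¹ ∑_q ᾱ(q)⁻¹ ρ(q.out) v`. -/
noncomputable def projQ (ᾱ : AddChar (A ⧸ K) ℂ) (v : V) : V :=
  (Fintype.card (A ⧸ K) : ℂ)⁻¹ • ∑ q : A ⧸ K, (ᾱ q)⁻¹ • ρ (ofAdd q.out) v

/-- The cardinality of the quotient is a non-zero complex number. -/
theorem card_quot_ne_zero : (Fintype.card (A ⧸ K) : ℂ) ≠ 0 :=
  Nat.cast_ne_zero.mpr Fintype.card_ne_zero

/-- `ρ b ∘ e_ᾱ = ᾱ(b̄) • e_ᾱ` on `K`-fixed vectors (reindex the cosets by `q ↦ b̄ + q`). -/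
theorem rho_projQ (ᾱ : AddChar (A ⧸ K) ℂ) {v : V} (hv : v ∈ fixedBy ρ K) (b : A) :
    ρ (ofAdd b) (projQ ρ K ᾱ v) = ᾱ (b : A ⧸ K) • projQ ρ K ᾱ v := by
  unfold projQ
  rw [map_smul, map_sum, smul_comm (ᾱ (b : A ⧸ K))]
  congr 1
  rw [Finset.smul_sum]
  refine (Fintype.sum_equiv (Equiv.addLeft (b : A ⧸ K))
    (fun q : A ⧸ K => ρ (ofAdd b) ((ᾱ q)⁻¹ • ρ (ofAdd q.out) v))
    (fun q : A ⧸ K => (ᾱ (q - (b : A ⧸ K)))⁻¹ • ρ (ofAdd q.out) v) fun q => ?_).trans ?_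
  · show ρ (ofAdd b) ((ᾱ q)⁻¹ • ρ (ofAdd q.out) v) =
      (ᾱ ((b : A ⧸ K) + q - (b : A ⧸ K)))⁻¹ • ρ (ofAdd ((b : A ⧸ K) + q).out) v
    rw [map_smul, add_sub_cancel_left, ← Module.End.mul_apply, ← map_mul, ← ofAdd_add]
    congr 1
    -- `b + q.out` and `(b̄ + q).out` have the same class
    refine rho_eq_of_mk_eq hv ?_
    simp only [QuotientAddGroup.mk_add, QuotientAddGroup.out_eq']
  · refine Finset.sum_congr rfl fun q _ => ?_
    rw [AddChar.map_sub_eq_div, inv_div, div_eq_mul_inv, mul_comm, mul_smul, smul_comm]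

/-- `e_ᾱ v` is `(ᾱ ∘ mk)`-isotypic for `K`-fixed `v`. -/
theorem projQ_mem_isotypic (ᾱ : AddChar (A ⧸ K) ℂ) {v : V} (hv : v ∈ fixedBy ρ K) :
    projQ ρ K ᾱ v ∈ isotypic ρ (inflate K ᾱ) :=
  fun b => rho_projQ ρ K ᾱ hv b

variable [DecidableEq (A ⧸ K)]

/-- `∑_ᾱ e_ᾱ v = v` for `K`-fixed `v` (dual orthogonality on the finite quotient, and
`ρ((0 : A/K).out) v = v`). -/
theorem sum_projQ {v : V} (hv : v ∈ fixedBy ρ K) :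
    ∑ ᾱ : AddChar (A ⧸ K) ℂ, projQ ρ K ᾱ v = v := by
  unfold projQ
  rw [← Finset.smul_sum, Finset.sum_comm]
  have h1 : ∀ q : A ⧸ K, ∑ ᾱ : AddChar (A ⧸ K) ℂ, (ᾱ q)⁻¹ • ρ (ofAdd q.out) v =
      (if q = 0 then (Fintype.card (A ⧸ K) : ℂ) else 0) • ρ (ofAdd q.out) v := by
    intro q
    rw [← Finset.sum_smul]
    congr 1
    have h := AddChar.sum_apply_eq_ite (α := A ⧸ K) (-q)
    simp only [neg_eq_zero] at h
    rw [← h]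
    exact Finset.sum_congr rfl fun ᾱ _ => (AddChar.map_neg_eq_inv ᾱ q).symm
  simp_rw [h1, ite_smul, zero_smul]
  rw [Finset.sum_ite_eq' Finset.univ (0 : A ⧸ K)]
  have h0 : ρ (ofAdd (0 : A ⧸ K).out) v = v := by
    refine hv _ ?_
    have := QuotientAddGroup.out_eq' (0 : A ⧸ K)
    rwa [QuotientAddGroup.eq_zero_iff] at this
  simp only [Finset.mem_univ, if_true, h0, smul_smul, inv_mul_cancel₀ (card_quot_ne_zero K),
    one_smul]

/-- A `K`-fixed vector is a sum of isotypic vectors (one per character of `A ⧸ K`). -/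
theorem mem_iSup_isotypic_of_mem_fixedBy {v : V} (hv : v ∈ fixedBy ρ K) :
    v ∈ ⨆ α : AddChar A ℂ, isotypic ρ α := by
  rw [← sum_projQ ρ K hv]
  exact Submodule.sum_mem _ fun ᾱ _ =>
    Submodule.mem_iSup_of_mem (inflate K ᾱ) (projQ_mem_isotypic ρ K ᾱ hv)

end Quotient

/-- SPANNING for smooth representations: if every vector is fixed by some subgroup of finite
index, the isotypic subspaces span `V`. -/
theorem iSup_isotypic_eq_top_of_smooth (ρ : Representation ℂ (Multiplicative A) V)
    (hsmooth : ∀ v : V, ∃ K : AddSubgroup A, K.FiniteIndex ∧ v ∈ fixedBy ρ K) :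
    ⨆ α : AddChar A ℂ, isotypic ρ α = ⊤ := by
  rw [eq_top_iff]
  intro v _
  obtain ⟨K, hK, hv⟩ := hsmooth v
  haveI := hK
  haveI : Fintype (A ⧸ K) := Fintype.ofFinite _
  classical
  exact mem_iSup_isotypic_of_mem_fixedBy ρ K hv

/-- A functional applied to `ρ b` of a finite sum of isotypic vectors. -/
theorem dual_apply_rho_sum (ρ : Representation ℂ (Multiplicative A) V) (ℓ : Module.Dual ℂ V)
    (s : Finset (AddChar A ℂ)) (v : AddChar A ℂ → V) (hv : ∀ α ∈ s, v α ∈ isotypic ρ α) (b : A) :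
    ℓ (ρ (ofAdd b) (∑ α ∈ s, v α)) = ∑ α ∈ s, ℓ (v α) * α b := by
  rw [map_sum, map_sum]
  refine Finset.sum_congr rfl fun α hα => ?_
  rw [hv α hα b, map_smul, smul_eq_mul, mul_comm]

/-- Distinct characters of `A` are linearly independent as functions `A → ℂ` (Dedekind, through
`linearIndependent_monoidHom` on `Multiplicative A`). -/
theorem linearIndependent_addChar :
    LinearIndependent ℂ (fun α : AddChar A ℂ => (⇑α : A → ℂ)) := by
  have h := linearIndependent_monoidHom (Multiplicative A) ℂ
  -- compose with the injection `AddChar A ℂ → (Multiplicative A →* ℂ)`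
  have hinj : Function.Injective (fun α : AddChar A ℂ => α.toMonoidHom) := by
    intro α β hαβ
    ext a
    have := DFunLike.congr_fun hαβ (ofAdd a)
    simpa using this
  have h2 := h.comp _ hinj
  -- the two function families agree
  have : (fun α : AddChar A ℂ => (⇑α : A → ℂ)) =
      (fun f : Multiplicative A →* ℂ => (⇑f : Multiplicative A → ℂ)) ∘
        (fun α : AddChar A ℂ => α.toMonoidHom) := by
    funext α
    rfl
  rw [this]
  exact h2

/-- The finite-sum form of independence. -/
theorem eq_zero_of_sum_eq_zero (ρ : Representation ℂ (Multiplicative A) V)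
    (s : Finset (AddChar A ℂ)) (v : AddChar A ℂ → V) (hv : ∀ α ∈ s, v α ∈ isotypic ρ α)
    (hsum : ∑ α ∈ s, v α = 0) : ∀ α ∈ s, v α = 0 := by
  intro α hα
  rw [← Module.forall_dual_apply_eq_zero_iff ℂ]
  intro ℓ
  have hfun : ∑ α' ∈ s, ℓ (v α') • (⇑α' : A → ℂ) = 0 := by
    funext b
    simp only [Finset.sum_apply, Pi.smul_apply, smul_eq_mul, Pi.zero_apply]
    rw [← dual_apply_rho_sum ρ ℓ s v hv b, hsum, map_zero, map_zero]
  exact linearIndependent_iff'.mp linearIndependent_addChar s _ hfun α hα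

/-- INDEPENDENCE: the isotypic subspaces of distinct characters are independent (no finiteness,
no smoothness). -/
theorem iSupIndep_isotypic (ρ : Representation ℂ (Multiplicative A) V) :
    iSupIndep fun α : AddChar A ℂ => isotypic ρ α := by
  classical
  refine iSupIndep_of_dfinsupp_lsum_injective _ ?_
  rw [injective_iff_map_eq_zero]
  intro f hf
  rw [DFinsupp.lsum_apply_apply, DFinsupp.sumAddHom_apply] at hf
  have hsum : ∑ α ∈ f.support, ((f α : isotypic ρ α) : V) = 0 := hf
  have hzero := eq_zero_of_sum_eq_zero ρ f.support (fun α => ((f α : isotypic ρ α) : V))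
    (fun α _ => (f α).2) hsum
  ext α
  by_cases hα : α ∈ f.support
  · have := hzero α hα
    simpa using this
  · rw [DFinsupp.notMem_support_iff] at hα
    simp [hα]

/-- THE STANDARD FACT (A1) for smooth representations of an arbitrary abelian group: if every
vector is fixed by a subgroup of finite index, `V` is the internal direct sum of the isotypic
subspaces `V[α]`, `α` running over all characters of `A`. -/
theorem isInternal_isotypic_of_smooth (ρ : Representation ℂ (Multiplicative A) V)
    (hsmooth : ∀ v : V, ∃ K : AddSubgroup A, K.FiniteIndex ∧ v ∈ fixedBy ρ K) :
    DirectSum.IsInternal fun α : AddChar A ℂ => isotypic ρ α := by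
  classical
  exact DirectSum.isInternal_submodule_of_iSupIndep_of_iSup_eq_top (iSupIndep_isotypic ρ)
    (iSup_isotypic_eq_top_of_smooth ρ hsmooth)

end Summit.Ventures.HodgeRepro2.T5SmoothIsotypic
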